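import Literature.NumberTheory.Automorphic.LieGraphSetup
import HarnessLib

/-!
# The Lie-algebra isomorphism theorem, II: the graph subalgebra contains no `(0, e_γ)`
(trunk T-AUTOMORPHIC, G25 AutomorphicL; Humphreys, *Introduction to Lie Algebras*, Thm. 14.2, the
"`M`-argument"; DAG of `chevalley_isomorphism`)

Continuation of `LieGraphSetup.lean` (`𝕃 = 𝔤𝔩_{n₁} × 𝔤𝔩_{n₂}`, the product weight spaces `PW x`, the
graph subalgebra `D = graphSubalgebra` generated by the pairs `(e¹_i, e²_i)`, `(f¹_i, f²_i)`, `i`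
simple for the regular coweight `y`, and the graph of `θ : Lie(T₁) ≅ Lie(T₂)`). The main result is
the component-free form of the heart of Humphreys' proof of the isomorphism theorem:

* **`not_inr_rootE_mem`** — `(0, e²_γ) ∉ D` for every root `α_γ` (and, symmetrically in the
  sequel, `(e¹_γ, 0) ∉ D`).

Proof. The set `C = {γ | (0, e²_γ) ∈ D}` is closed under `⟨α_j, α_i^∨⟩ ≠ 0, i ∈ C ⇒ j ∈ C`
(`mem_C_of_pairing_ne_zero`: bracket with an element of `D` over `f²_i`, then over `e²_j`,
`RootStrings`/`LieGraphSetup`); if it is non-empty, `exists_mem_pos_forall_add_notMem`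
(`RootSystemPositivity.lean`) gives `b ∈ C`, `y`-positive, with `α_b + α_a ∉ R` for all simple
`α_a`. Let `v̄ = (e¹_b, e²_b)` and let `W` be the span of the iterated brackets
`word b l = ad ȳ_{j₁} ⋯ ad ȳ_{jₘ} (v̄)` (`jᵣ` simple); `word b l ∈ PW (α_b - ∑ α_{jᵣ})`
(`word_mem_PW`). Every generator of `D` normalises `W` (`lie_generator_mem_wordSpan`: `ȳ_j` by
construction, `(H, θH)` since it is scalar on each `PW x`, `x̄_a` by induction on the word using
`[x̄_a, ȳ_j] ∈ {0, (h¹_a, h²_a)}` — the difference of two simple roots is not a root — and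
`[x̄_a, v̄] = 0`), so `D` does (`lie_mem_wordSpan_of_mem`, the normaliser being a Lie subalgebra).
But `(0, h²_b) ∈ D` and `[(0, h²_b), v̄] = (0, 2 e²_b)` lies in `W ∩ PW (α_b) = k v̄`
(`mem_span_vbar_of_mem_wordSpan_of_mem_PW`, by the independence of the product weight spaces,
`iSupIndep_PW`, the non-empty words having weights `≠ α_b`), forcing `e¹_b = 0` or `e²_b = 0`.

## Mathlib

`LieSubalgebra.lieSpan_le`, `LieModule.toEnd`, `leibniz_lie`, `iSupIndep` (`iSupIndep.comp`,
`iSupIndep.mono`, `iSupIndep_def`), `Submodule.span`, `Submodule.mem_sup`. Nothing here duplicates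
a Mathlib or Literature declaration (searched `wordSpan`, `graphSubalgebra`).

## References

* [Humphreys1972] J. E. Humphreys, *Introduction to Lie Algebras and Representation Theory*,
  GTM 9, Springer (1972), §14.2 (proof of the Theorem).
-/

noncomputable section

open scoped MatrixGroups IsMulCommutative
open Set

attribute [local instance 100] LieRing.ofAssociativeRing

namespace Literature.NumberTheory.Automorphic

namespace LieGraph

variable {k : Type*} [Field k]
variable {n₁ n₂ : Type*} [Fintype n₁] [DecidableEq n₁] [Fintype n₂] [DecidableEq n₂]
variable {ι X Y : Type*} [AddCommGroup X] [AddCommGroup Y]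
variable {G₁ T₁ : Subgroup (GL n₁ k)} {G₂ T₂ : Subgroup (GL n₂ k)}
  [IsMulCommutative ↥T₁] [IsMulCommutative ↥T₂]
variable {P : RootPairing ι ℤ X Y}
variable {eX₁ : Additive ↥(characterLattice T₁) ≃+ X} {eY₁ : Additive ↥(cocharacterLattice T₁) ≃+ Y}
variable {eX₂ : Additive ↥(characterLattice T₂) ≃+ X} {eY₂ : Additive ↥(cocharacterLattice T₂) ≃+ Y}

/-! ### Independence of the product weight spaces -/

section Indep

variable [IsAlgClosed k]

omit [IsMulCommutative ↥T₂] in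
/-- The weight spaces `𝔤_x = lieWeightSpace G T (χ_x)`, `x ∈ X`, are independent (distinct weights
give distinct characters; `iSupIndep_adWeightSpace`). [cite: SpringerLAG1998, 7.1.1] -/
theorem iSupIndep_lieWeightSpace_charOfWeight (hT : IsTorusSubgroup T₁)
    (eX₁ : Additive ↥(characterLattice T₁) ≃+ X) (G₁ : Subgroup (GL n₁ k)) :
    iSupIndep fun x : X => lieWeightSpace G₁ T₁ (charOfWeight eX₁ x) := by
  have hind := iSupIndep_adWeightSpace T₁ hT.2.2
  let F : X → (↥T₁ → k) := fun x t => ((charOfWeight eX₁ x t : kˣ) : k)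
  have hF : Function.Injective F := by
    intro x x' hxx'
    apply charOfWeight_injective eX₁
    refine MonoidHom.ext fun t => Units.ext ?_
    exact congrFun hxx' t
  have h2 := hind.comp hF
  refine h2.mono fun x => ?_
  change lieWeightSpace G₁ T₁ (charOfWeight eX₁ x) ≤ adWeightSpace T₁ (F x)
  rw [lieWeightSpace, weightSpaceGL_eq_adWeightSpace]
  exact inf_le_right

/-- **The product weight spaces `PW x`, `x ∈ X`, are independent.** [cite: SpringerLAG1998, 7.1.1] -/
theorem iSupIndep_PW (hT₁ : IsTorusSubgroup T₁) (hT₂ : IsTorusSubgroup T₂) :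
    iSupIndep (PW G₁ G₂ eX₁ eX₂) := by
  have i1 := iSupIndep_lieWeightSpace_charOfWeight hT₁ eX₁ G₁
  have i2 := iSupIndep_lieWeightSpace_charOfWeight hT₂ eX₂ G₂
  rw [iSupIndep_def] at i1 i2 ⊢
  intro x
  rw [Submodule.disjoint_def]
  intro A hA hA'
  -- the supremum of the other `PW x'` lies in the product of the suprema of the components
  have hle : (⨆ (x' : X) (_ : x' ≠ x), PW G₁ G₂ eX₁ eX₂ x') ≤
      (⨆ (x' : X) (_ : x' ≠ x), lieWeightSpace G₁ T₁ (charOfWeight eX₁ x')).prod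
        (⨆ (x' : X) (_ : x' ≠ x), lieWeightSpace G₂ T₂ (charOfWeight eX₂ x')) := by
    refine iSup_le fun x' => iSup_le fun hx' => ?_
    refine Submodule.prod_mono ?_ ?_
    · exact le_trans (le_iSup (fun _ : x' ≠ x => lieWeightSpace G₁ T₁ (charOfWeight eX₁ x')) hx')
        (le_iSup (fun x' => ⨆ (_ : x' ≠ x), lieWeightSpace G₁ T₁ (charOfWeight eX₁ x')) x')
    · exact le_trans (le_iSup (fun _ : x' ≠ x => lieWeightSpace G₂ T₂ (charOfWeight eX₂ x')) hx')
        (le_iSup (fun x' => ⨆ (_ : x' ≠ x), lieWeightSpace G₂ T₂ (charOfWeight eX₂ x')) x')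
  have hA'' := hle hA'
  rw [Submodule.mem_prod] at hA''
  rw [mem_PW_iff] at hA
  have e1 : A.1 = 0 := (Submodule.disjoint_def.1 (i1 x)) _ hA.1 hA''.1
  have e2 : A.2 = 0 := (Submodule.disjoint_def.1 (i2 x)) _ hA.2 hA''.2
  exact Prod.ext e1 e2

end Indep

/-! ### Words and their span -/

section Words

variable [IsAlgClosed k] [CharZero k]
variable (h₁ : IsRootDatumOf G₁ T₁ P eX₁ eY₁) (h₂ : IsRootDatumOf G₂ T₂ P eX₂ eY₂)

/-- The pair `ȳ_j = (f¹_j, f²_j)`. [folklore] -/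
def ybar (j : ι) : Matrix n₁ n₁ k × Matrix n₂ n₂ k := (h₁.rootF j, h₂.rootF j)

/-- The pair `x̄_j = (e¹_j, e²_j)`. [folklore] -/
def xbar (j : ι) : Matrix n₁ n₁ k × Matrix n₂ n₂ k := (h₁.rootE j, h₂.rootE j)

/-- **Humphreys' words** `ad ȳ_{j₁} ⋯ ad ȳ_{jₘ} (x̄_b)`. [cite: Humphreys1972, 14.2] -/
def word (b : ι) : List ι → Matrix n₁ n₁ k × Matrix n₂ n₂ k
  | [] => xbar h₁ h₂ b
  | j :: l => ⁅ybar h₁ h₂ j, word b l⁆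

/-- The weight `α_b - ∑ α_{jᵣ}` of the word indexed by `l = [j₁, …, jₘ]`. [folklore] -/
def wordWt (P : RootPairing ι ℤ X Y) (b : ι) (l : List ι) : X := P.root b - (l.map P.root).sum

omit [Fintype n₁] [DecidableEq n₁] [Fintype n₂] [DecidableEq n₂] [IsMulCommutative ↥T₁]
  [IsMulCommutative ↥T₂] [IsAlgClosed k] [CharZero k] in
/-- Unfolding of `wordWt` on `j :: l`. [folklore] -/
lemma wordWt_cons (b j : ι) (l : List ι) : wordWt P b (j :: l) = -P.root j + wordWt P b l := by
  simp only [wordWt, List.map_cons, List.sum_cons]; abel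

omit [CharZero k] in
/-- **`word b l ∈ PW (α_b - ∑ α_{jᵣ})`.** [cite: Humphreys1972, 14.2] -/
theorem word_mem_PW (b : ι) (l : List ι) : word h₁ h₂ b l ∈ PW G₁ G₂ eX₁ eX₂ (wordWt P b l) := by
  haveI : Infinite k := IsAlgClosed.instInfinite
  induction l with
  | nil =>
    simp only [word, wordWt, List.map_nil, List.sum_nil, sub_zero]
    exact mem_PW_iff.2 ⟨h₁.rootE_mem b, h₂.rootE_mem b⟩
  | cons j l ih =>
    rw [word, wordWt_cons]
    exact lie_mem_PW (mem_PW_iff.2 ⟨h₁.rootF_mem' j, h₂.rootF_mem' j⟩) ih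

/-- The set of words on the simple roots `Δ`. [folklore] -/
def wordSet (Δ : Set ι) (b : ι) : Set (Matrix n₁ n₁ k × Matrix n₂ n₂ k) :=
  {w | ∃ l : List ι, (∀ j ∈ l, j ∈ Δ) ∧ word h₁ h₂ b l = w}

/-- **The span `W` of the words** (Humphreys' `M`). [cite: Humphreys1972, 14.2] -/
def wordSpan (Δ : Set ι) (b : ι) : Submodule k (Matrix n₁ n₁ k × Matrix n₂ n₂ k) :=
  Submodule.span k (wordSet h₁ h₂ Δ b)

omit [IsAlgClosed k] [CharZero k] in
/-- `x̄_b ∈ W` (the empty word). [folklore] -/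
lemma xbar_mem_wordSpan (Δ : Set ι) (b : ι) : xbar h₁ h₂ b ∈ wordSpan h₁ h₂ Δ b :=
  Submodule.subset_span ⟨[], by simp, rfl⟩

omit [IsAlgClosed k] [CharZero k] in
/-- `W` is stable under `ad ȳ_j`, `j ∈ Δ`. [cite: Humphreys1972, 14.2] -/
theorem lie_ybar_mem_wordSpan {Δ : Set ι} {b j : ι} (hj : j ∈ Δ) {w : Matrix n₁ n₁ k × Matrix n₂ n₂ k}
    (hw : w ∈ wordSpan h₁ h₂ Δ b) : ⁅ybar h₁ h₂ j, w⁆ ∈ wordSpan h₁ h₂ Δ b := by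
  rw [← LieModule.toEnd_apply_apply k]
  refine (Submodule.span_le (p := (wordSpan h₁ h₂ Δ b).comap
    (LieModule.toEnd k _ (Matrix n₁ n₁ k × Matrix n₂ n₂ k) (ybar h₁ h₂ j)))).2 ?_ hw
  rintro _ ⟨l, hl, rfl⟩
  rw [SetLike.mem_coe, Submodule.mem_comap, LieModule.toEnd_apply_apply]
  refine Submodule.subset_span ⟨j :: l, fun i hi => ?_, rfl⟩
  rcases List.mem_cons.1 hi with rfl | hi
  · exact hj
  · exact hl i hi

omit [CharZero k] in
/-- `W` is stable under any endomorphism that is scalar on each `PW x`: applied to `ad (H, θH)` and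
`ad (h¹_a, h²_a)`. [folklore] -/
theorem toEnd_mem_wordSpan_of_forall_PW {Δ : Set ι} {b : ι} (d : Matrix n₁ n₁ k × Matrix n₂ n₂ k)
    (hd : ∀ (x : X) (A : Matrix n₁ n₁ k × Matrix n₂ n₂ k), A ∈ PW G₁ G₂ eX₁ eX₂ x → ∃ c : k, ⁅d, A⁆ = c • A)
    {w : Matrix n₁ n₁ k × Matrix n₂ n₂ k} (hw : w ∈ wordSpan h₁ h₂ Δ b) : ⁅d, w⁆ ∈ wordSpan h₁ h₂ Δ b := by
  rw [← LieModule.toEnd_apply_apply k]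
  refine (Submodule.span_le (p := (wordSpan h₁ h₂ Δ b).comap
    (LieModule.toEnd k _ (Matrix n₁ n₁ k × Matrix n₂ n₂ k) d))).2 ?_ hw
  rintro _ ⟨l, hl, rfl⟩
  rw [SetLike.mem_coe, Submodule.mem_comap, LieModule.toEnd_apply_apply]
  obtain ⟨c, hc⟩ := hd _ _ (word_mem_PW h₁ h₂ b l)
  rw [hc]
  exact Submodule.smul_mem _ c (Submodule.subset_span ⟨l, hl, rfl⟩)

end Words

/-! ### The generators normalise `W` -/

section Normalise

variable [IsAlgClosed k] [CharZero k] [Finite ι]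
variable (hG₁ : IsConnectedReductive G₁) (hT₁ : IsMaximalTorusIn T₁ G₁)
  (hG₂ : IsConnectedReductive G₂) (hT₂ : IsMaximalTorusIn T₂ G₂)
  (h₁ : IsRootDatumOf G₁ T₁ P eX₁ eY₁) (h₂ : IsRootDatumOf G₂ T₂ P eX₂ eY₂)

omit [IsAlgClosed k] [Finite ι] in
include hG₁ hT₁ hG₂ hT₂ h₁ h₂ in
/-- An element of `PW x` with `x ≠ 0` not a root is zero. [folklore] -/
lemma eq_zero_of_mem_PW {x : X} (hx0 : x ≠ 0) (hx : x ∉ range P.root)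
    {A : Matrix n₁ n₁ k × Matrix n₂ n₂ k} (hA : A ∈ PW G₁ G₂ eX₁ eX₂ x) : A = 0 := by
  rw [mem_PW_iff, h₁.lieWeightSpace_charOfWeight_eq_bot hG₁ hT₁ hx0 hx,
    h₂.lieWeightSpace_charOfWeight_eq_bot hG₂ hT₂ hx0 hx, Submodule.mem_bot, Submodule.mem_bot] at hA
  exact Prod.ext hA.1 hA.2

omit [Finite ι] in
include hG₁ hT₁ hG₂ hT₂ in
/-- `[x̄_a, ȳ_j] = 0` for distinct simple roots `a ≠ j` (the difference of two simple roots is not a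
root). [cite: Humphreys1972, 14.2] -/
theorem lie_xbar_ybar_of_ne {y : Y} (hy : ∀ i, P.root' i y ≠ 0) {a j : ι} (ha : a ∈ simpleRoots P y)
    (hj : j ∈ simpleRoots P y) (haj : a ≠ j) : ⁅xbar h₁ h₂ a, ybar h₁ h₂ j⁆ = 0 := by
  haveI : Infinite k := IsAlgClosed.instInfinite
  have hmem : ⁅xbar h₁ h₂ a, ybar h₁ h₂ j⁆ ∈ PW G₁ G₂ eX₁ eX₂ (P.root a + -P.root j) :=
    lie_mem_PW (mem_PW_iff.2 ⟨h₁.rootE_mem a, h₂.rootE_mem a⟩) (mem_PW_iff.2 ⟨h₁.rootF_mem' j, h₂.rootF_mem' j⟩)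
  refine eq_zero_of_mem_PW hG₁ hT₁ hG₂ hT₂ h₁ h₂ ?_ ?_ hmem
  · rw [← sub_eq_add_neg, sub_ne_zero]
    exact fun h => haj (P.root.injective h)
  · rw [← sub_eq_add_neg]
    exact root_sub_root_notMem_of_mem_simpleRoots hy ha hj haj

omit [CharZero k] [Finite ι] in
/-- `[x̄_a, ȳ_a] = (h¹_a, h²_a)`. [cite: Humphreys1972, 14.2] -/
theorem lie_xbar_ybar_self (a : ι) : ⁅xbar h₁ h₂ a, ybar h₁ h₂ a⁆ = (h₁.rootH a, h₂.rootH a) := by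
  haveI : Infinite k := IsAlgClosed.instInfinite
  rw [xbar, ybar, bracket_eq]
  exact Prod.ext (h₁.lie_rootE_rootF a) (h₂.lie_rootE_rootF a)

omit [Finite ι] in
include hG₁ hT₁ hG₂ hT₂ in
/-- **`W` is stable under `ad x̄_a`, `a` simple**, provided `α_b + α_a` is neither `0` nor a root
for all simple `a` (induction on the word: `[x̄_a, x̄_b] = 0`, and
`[x̄_a, [ȳ_j, w]] = [[x̄_a, ȳ_j], w] + [ȳ_j, [x̄_a, w]]` with `[x̄_a, ȳ_j] ∈ {0, (h¹_a, h²_a)}`).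
[cite: Humphreys1972, 14.2] -/
theorem lie_xbar_mem_wordSpan {y : Y} (hy : ∀ i, P.root' i y ≠ 0) {b : ι}
    (hb : ∀ a ∈ simpleRoots P y, P.root b + P.root a ∉ range P.root)
    (hb0 : ∀ a ∈ simpleRoots P y, P.root b + P.root a ≠ 0)
    {a : ι} (ha : a ∈ simpleRoots P y) {w : Matrix n₁ n₁ k × Matrix n₂ n₂ k}
    (hw : w ∈ wordSpan h₁ h₂ (simpleRoots P y) b) :
    ⁅xbar h₁ h₂ a, w⁆ ∈ wordSpan h₁ h₂ (simpleRoots P y) b := by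
  haveI : Infinite k := IsAlgClosed.instInfinite
  rw [← LieModule.toEnd_apply_apply k]
  refine (Submodule.span_le (p := (wordSpan h₁ h₂ (simpleRoots P y) b).comap
    (LieModule.toEnd k _ (Matrix n₁ n₁ k × Matrix n₂ n₂ k) (xbar h₁ h₂ a)))).2 ?_ hw
  rintro _ ⟨l, hl, rfl⟩
  rw [SetLike.mem_coe, Submodule.mem_comap, LieModule.toEnd_apply_apply]
  induction l with
  | nil =>
    -- `[x̄_a, x̄_b] ∈ PW (α_a + α_b) = 0`
    have hmem : ⁅xbar h₁ h₂ a, word h₁ h₂ b []⁆ ∈ PW G₁ G₂ eX₁ eX₂ (P.root a + P.root b) :=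
      lie_mem_PW (mem_PW_iff.2 ⟨h₁.rootE_mem a, h₂.rootE_mem a⟩) (mem_PW_iff.2 ⟨h₁.rootE_mem b, h₂.rootE_mem b⟩)
    rw [eq_zero_of_mem_PW hG₁ hT₁ hG₂ hT₂ h₁ h₂ (by rw [add_comm]; exact hb0 a ha)
      (by rw [add_comm]; exact hb a ha) hmem]
    exact Submodule.zero_mem _
  | cons j l ih =>
    have hjΔ : j ∈ simpleRoots P y := hl j List.mem_cons_self
    have hl' : ∀ i ∈ l, i ∈ simpleRoots P y := fun i hi => hl i (List.mem_cons_of_mem j hi)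
    rw [word, leibniz_lie]
    refine Submodule.add_mem _ ?_ (lie_ybar_mem_wordSpan h₁ h₂ hjΔ (ih hl'))
    by_cases haj : a = j
    · subst haj
      rw [lie_xbar_ybar_self]
      refine toEnd_mem_wordSpan_of_forall_PW h₁ h₂ _ (fun x A hA => ?_)
        (Submodule.subset_span ⟨l, hl', rfl⟩)
      exact ⟨_, lie_rootH_pair_of_mem_PW (h₁ := h₁) (h₂ := h₂) a hA⟩
    · rw [lie_xbar_ybar_of_ne hG₁ hT₁ hG₂ hT₂ h₁ h₂ hy ha hjΔ haj, zero_lie]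
      exact Submodule.zero_mem _

/-- The normaliser of a subspace `W` under the adjoint action: a Lie subalgebra. [folklore] -/
def normaliser (W : Submodule k (Matrix n₁ n₁ k × Matrix n₂ n₂ k)) :
    LieSubalgebra k (Matrix n₁ n₁ k × Matrix n₂ n₂ k) where
  carrier := {d | ∀ w ∈ W, ⁅d, w⁆ ∈ W}
  zero_mem' := fun w _ => by rw [zero_lie]; exact W.zero_mem
  add_mem' := fun {a b} ha hb w hw => by rw [add_lie]; exact W.add_mem (ha w hw) (hb w hw)
  smul_mem' := fun c {a} ha w hw => by rw [smul_lie]; exact W.smul_mem c (ha w hw)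
  lie_mem' := fun {a b} ha hb w hw => by
    rw [lie_lie]
    exact W.sub_mem (ha _ (hb w hw)) (hb _ (ha w hw))

omit [IsMulCommutative ↥T₁] [IsMulCommutative ↥T₂] [IsAlgClosed k] [CharZero k] [Finite ι] in
/-- Membership in `normaliser W`. [folklore] -/
lemma mem_normaliser_iff {W : Submodule k (Matrix n₁ n₁ k × Matrix n₂ n₂ k)}
    {d : Matrix n₁ n₁ k × Matrix n₂ n₂ k} : d ∈ normaliser W ↔ ∀ w ∈ W, ⁅d, w⁆ ∈ W := Iff.rfl

omit [Finite ι] in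
include hG₁ hG₂ in
/-- **`D` normalises `W`** (all generators do). [cite: Humphreys1972, 14.2] -/
theorem lie_mem_wordSpan_of_mem {y : Y} (hy : ∀ i, P.root' i y ≠ 0) {b : ι}
    (hb : ∀ a ∈ simpleRoots P y, P.root b + P.root a ∉ range P.root)
    (hb0 : ∀ a ∈ simpleRoots P y, P.root b + P.root a ≠ 0)
    {d : Matrix n₁ n₁ k × Matrix n₂ n₂ k} (hd : d ∈ graphSubalgebra hT₁ hT₂ h₁ h₂ y)
    {w : Matrix n₁ n₁ k × Matrix n₂ n₂ k} (hw : w ∈ wordSpan h₁ h₂ (simpleRoots P y) b) :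
    ⁅d, w⁆ ∈ wordSpan h₁ h₂ (simpleRoots P y) b := by
  suffices hle : graphSubalgebra hT₁ hT₂ h₁ h₂ y ≤ normaliser (wordSpan h₁ h₂ (simpleRoots P y) b) from
    hle hd w hw
  rw [graphSubalgebra, LieSubalgebra.lieSpan_le]
  rintro s ((⟨i, hi, rfl⟩ | ⟨i, hi, rfl⟩) | ⟨H, rfl⟩)
  · exact fun w hw => lie_xbar_mem_wordSpan hG₁ hT₁ hG₂ hT₂ h₁ h₂ hy hb hb0 hi hw
  · exact fun w hw => lie_ybar_mem_wordSpan h₁ h₂ hi hw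
  · intro w hw
    refine toEnd_mem_wordSpan_of_forall_PW h₁ h₂ _ (fun x A hA => ?_) hw
    exact ⟨_, lie_graph_of_mem_PW (hT₁ := hT₁) (hT₂ := hT₂) H hA⟩

end Normalise

/-! ### The weight-`α_b` part of `W` and the contradiction -/

section Contradiction

variable [IsAlgClosed k] [CharZero k] [Finite ι]
variable (hG₁ : IsConnectedReductive G₁) (hT₁ : IsMaximalTorusIn T₁ G₁)
  (hG₂ : IsConnectedReductive G₂) (hT₂ : IsMaximalTorusIn T₂ G₂)
  (h₁ : IsRootDatumOf G₁ T₁ P eX₁ eY₁) (h₂ : IsRootDatumOf G₂ T₂ P eX₂ eY₂)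

omit [CharZero k] [Finite ι] in
include hT₁ hT₂ in
/-- **`W ∩ PW (α_b) = k x̄_b`** when `b` is `y`-positive: a non-empty word has weight
`α_b - ∑ α_{jᵣ} ≠ α_b` (each simple root is `y`-positive), and the product weight spaces are
independent. [cite: Humphreys1972, 14.2] -/
theorem mem_span_xbar_of_mem_wordSpan_of_mem_PW {y : Y} {b : ι}
    {w : Matrix n₁ n₁ k × Matrix n₂ n₂ k} (hw : w ∈ wordSpan h₁ h₂ (simpleRoots P y) b)
    (hwb : w ∈ PW G₁ G₂ eX₁ eX₂ (P.root b)) : ∃ c : k, w = c • xbar h₁ h₂ b := by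
  -- `W ≤ k x̄_b ⊔ Q`, `Q` the supremum of the other product weight spaces
  set Q : Submodule k (Matrix n₁ n₁ k × Matrix n₂ n₂ k) :=
    ⨆ (x : X) (_ : x ≠ P.root b), PW G₁ G₂ eX₁ eX₂ x with hQ
  have hle : wordSpan h₁ h₂ (simpleRoots P y) b ≤ (k ∙ xbar h₁ h₂ b) ⊔ Q := by
    rw [wordSpan, Submodule.span_le]
    rintro _ ⟨l, hl, rfl⟩
    cases l with
    | nil => exact Submodule.mem_sup_left (Submodule.mem_span_singleton_self _)
    | cons j l =>
      refine Submodule.mem_sup_right ?_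
      have hne : wordWt P b (j :: l) ≠ P.root b := by
        intro heq
        rw [wordWt, sub_eq_self] at heq
        -- the sum of the simple roots `α_j + ∑ α_l` is `y`-positive
        have hpos : 0 < coweightForm P y ((List.map P.root (j :: l)).sum) := by
          rw [map_list_sum, List.map_map]
          apply List.sum_pos
          · intro a ha
            rw [List.mem_map] at ha
            obtain ⟨i, hi, rfl⟩ := ha
            exact coweightForm_pos_of_mem_simpleRoots (hl i hi)
          · simp
        rw [heq, map_zero] at hpos
        exact lt_irrefl _ hpos
      exact (le_iSup₂ (f := fun (x : X) (_ : x ≠ P.root b) => PW G₁ G₂ eX₁ eX₂ x) _ hne)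
        (word_mem_PW h₁ h₂ b (j :: l))
  obtain ⟨v, hv, q, hq, hvq⟩ := Submodule.mem_sup.1 (hle hw)
  obtain ⟨c, rfl⟩ := Submodule.mem_span_singleton.1 hv
  refine ⟨c, ?_⟩
  -- `q = w - c x̄_b ∈ PW (α_b) ∩ Q = 0`
  have hqb : q ∈ PW G₁ G₂ eX₁ eX₂ (P.root b) := by
    have : q = w - c • xbar h₁ h₂ b := by rw [← hvq]; abel
    rw [this]
    exact Submodule.sub_mem _ hwb (Submodule.smul_mem _ c (mem_PW_iff.2 ⟨h₁.rootE_mem b, h₂.rootE_mem b⟩))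
  have hdis := (iSupIndep_def.1 (iSupIndep_PW (G₁ := G₁) (G₂ := G₂) (eX₁ := eX₁) (eX₂ := eX₂)
    hT₁.2.1 hT₂.2.1)) (P.root b)
  have hq0 : q = 0 := (Submodule.disjoint_def.1 hdis) q hqb hq
  rw [← hvq, hq0, add_zero]

omit [IsMulCommutative ↥T₁] [IsMulCommutative ↥T₂] [IsAlgClosed k] [CharZero k] [Finite ι] in
/-- The second-component bracket with `(0, B)`. [folklore] -/
lemma inr_lie (B : Matrix n₂ n₂ k) (d : Matrix n₁ n₁ k × Matrix n₂ n₂ k) :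
    ⁅(((0 : Matrix n₁ n₁ k), B) : Matrix n₁ n₁ k × Matrix n₂ n₂ k), d⁆ = (0, B * d.2 - d.2 * B) := by
  rw [bracket_eq]; simp

include hG₂ hT₂ in
/-- **Closure of `C = {γ | (0, e²_γ) ∈ D}`**: from `(0, e²_i) ∈ D` one gets `(0, h²_i) ∈ D` (bracket
with an element over `f²_i`) and then `(0, e²_j) ∈ D` whenever `⟨α_j, α_i^∨⟩ ≠ 0` (bracket with an
element over `e²_j`). [cite: Humphreys1972, 14.2] -/
theorem inr_rootH_mem_of_inr_rootE_mem {y : Y} (hy : ∀ i, P.root' i y ≠ 0) {i : ι}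
    (hi : (((0 : Matrix n₁ n₁ k), h₂.rootE i) : Matrix n₁ n₁ k × Matrix n₂ n₂ k) ∈ graphSubalgebra hT₁ hT₂ h₁ h₂ y) :
    (((0 : Matrix n₁ n₁ k), h₂.rootH i) : Matrix n₁ n₁ k × Matrix n₂ n₂ k) ∈ graphSubalgebra hT₁ hT₂ h₁ h₂ y := by
  haveI : Infinite k := IsAlgClosed.instInfinite
  obtain ⟨d, hd, hd2⟩ := exists_mem_snd_eq_rootF (hG₂ := hG₂) (hT₁ := hT₁) (hT₂ := hT₂) (h₁ := h₁) (h₂ := h₂) hy i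
  have h := (graphSubalgebra hT₁ hT₂ h₁ h₂ y).lie_mem hi hd
  rwa [inr_lie, hd2, h₂.lie_rootE_rootF] at h

include hG₂ hT₂ in
/-- `(0, e²_i) ∈ D`, `⟨α_j, α_i^∨⟩ ≠ 0 ⇒ (0, e²_j) ∈ D`. [cite: Humphreys1972, 14.2] -/
theorem mem_C_of_pairing_ne_zero {y : Y} (hy : ∀ i, P.root' i y ≠ 0) {i : ι}
    (hi : (((0 : Matrix n₁ n₁ k), h₂.rootE i) : Matrix n₁ n₁ k × Matrix n₂ n₂ k) ∈ graphSubalgebra hT₁ hT₂ h₁ h₂ y)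
    {j : ι} (hji : P.pairing j i ≠ 0) :
    (((0 : Matrix n₁ n₁ k), h₂.rootE j) : Matrix n₁ n₁ k × Matrix n₂ n₂ k) ∈ graphSubalgebra hT₁ hT₂ h₁ h₂ y := by
  haveI : Infinite k := IsAlgClosed.instInfinite
  have hH := inr_rootH_mem_of_inr_rootE_mem (hG₂ := hG₂) (hT₁ := hT₁) (hT₂ := hT₂) (h₁ := h₁) (h₂ := h₂) hy hi
  obtain ⟨d, hd, hd2⟩ := exists_mem_snd_eq_rootE (hG₂ := hG₂) (hT₁ := hT₁) (hT₂ := hT₂) (h₁ := h₁) (h₂ := h₂) hy j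
  have h := (graphSubalgebra hT₁ hT₂ h₁ h₂ y).lie_mem hH hd
  rw [inr_lie, hd2, h₂.lie_rootH_rootE_eq] at h
  have hc : ((P.pairing j i : ℤ) : k) ≠ 0 := by exact_mod_cast hji
  have := (graphSubalgebra hT₁ hT₂ h₁ h₂ y).smul_mem ((P.pairing j i : ℤ) : k)⁻¹ h
  rwa [Prod.smul_mk, smul_zero, smul_smul, inv_mul_cancel₀ hc, one_smul] at this

include hG₁ hT₁ hG₂ hT₂ in
/-- **`(0, e²_γ) ∉ D` for every root `α_γ`** (Humphreys 14.2, the `M`-argument, component-free).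
[cite: Humphreys1972, 14.2] -/
theorem not_inr_rootE_mem {y : Y} (hy : ∀ i, P.root' i y ≠ 0) (γ : ι) :
    (((0 : Matrix n₁ n₁ k), h₂.rootE γ) : Matrix n₁ n₁ k × Matrix n₂ n₂ k) ∉ graphSubalgebra hT₁ hT₂ h₁ h₂ y := by
  haveI : Infinite k := IsAlgClosed.instInfinite
  intro hγ
  set C : Set ι := {i | (((0 : Matrix n₁ n₁ k), h₂.rootE i) : Matrix n₁ n₁ k × Matrix n₂ n₂ k) ∈
    graphSubalgebra hT₁ hT₂ h₁ h₂ y} with hC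
  have hCne : C.Nonempty := ⟨γ, hγ⟩
  have hcl : ∀ i ∈ C, ∀ j, P.pairing j i ≠ 0 → j ∈ C :=
    fun i hi j hji => mem_C_of_pairing_ne_zero (hG₂ := hG₂) (hT₁ := hT₁) (hT₂ := hT₂) (h₁ := h₁) (h₂ := h₂) hy hi hji
  obtain ⟨b, hbC, hbpos, hb⟩ := exists_mem_pos_forall_add_notMem hy hCne hcl
  have hb0 : ∀ a ∈ simpleRoots P y, P.root b + P.root a ≠ 0 := by
    intro a ha h0
    have hapos : 0 < P.root' a y := coweightForm_pos_of_mem_simpleRoots ha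
    have : P.root' b y + P.root' a y = 0 := by
      change P.toLinearMap (P.root b) y + P.toLinearMap (P.root a) y = 0
      rw [← LinearMap.add_apply, ← map_add, h0, map_zero, LinearMap.zero_apply]
    linarith
  -- `(0, h²_b) ∈ D` acts on `x̄_b ∈ W`
  have hHb := inr_rootH_mem_of_inr_rootE_mem (hG₂ := hG₂) (hT₁ := hT₁) (hT₂ := hT₂) (h₁ := h₁) (h₂ := h₂) hy hbC
  have hW := lie_mem_wordSpan_of_mem hG₁ hT₁ hG₂ hT₂ h₁ h₂ hy hb hb0 hHb
    (xbar_mem_wordSpan h₁ h₂ (simpleRoots P y) b)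
  -- `[(0, h²_b), x̄_b] = (0, 2 e²_b) ∈ PW (α_b)`
  have hval : ⁅(((0 : Matrix n₁ n₁ k), h₂.rootH b) : Matrix n₁ n₁ k × Matrix n₂ n₂ k), xbar h₁ h₂ b⁆ =
      ((0 : Matrix n₁ n₁ k), (2 : k) • h₂.rootE b) := by
    rw [inr_lie, xbar, h₂.lie_rootH_rootE]
  rw [hval] at hW
  have hPW : (((0 : Matrix n₁ n₁ k), (2 : k) • h₂.rootE b) : Matrix n₁ n₁ k × Matrix n₂ n₂ k) ∈
      PW G₁ G₂ eX₁ eX₂ (P.root b) :=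
    mem_PW_iff.2 ⟨Submodule.zero_mem _, Submodule.smul_mem _ _ (h₂.rootE_mem b)⟩
  obtain ⟨c, hc⟩ := mem_span_xbar_of_mem_wordSpan_of_mem_PW hT₁ hT₂ h₁ h₂ hW hPW
  -- compare components: `c e¹_b = 0`, so `c = 0`, so `2 e²_b = 0`
  have h1 := congrArg Prod.fst hc
  have h2 := congrArg Prod.snd hc
  simp only [xbar, Prod.smul_fst, Prod.smul_snd] at h1 h2
  have hc0 : c = 0 := by
    by_contra hc0
    exact h₁.rootE_ne_zero b ((smul_eq_zero.1 h1.symm).resolve_left hc0)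
  rw [hc0, zero_smul] at h2
  exact h₂.rootE_ne_zero b ((smul_eq_zero.1 h2).resolve_left two_ne_zero)

end Contradiction

end LieGraph

end Literature.NumberTheory.Automorphic
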